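import Mathlib.ModelTheory.Algebra.Ring.Basic
import Mathlib.ModelTheory.Algebra.Field.Basic
import Mathlib.Algebra.BigOperators.Pi
import Mathlib.Algebra.BigOperators.Fin
import Mathlib.Data.Fintype.Pi
import HarnessLib

/-!
# Definable predicates over fields: closure properties of "one ring formula, uniformly"

Topic `Literature/ModelTheory/PseudofiniteFields`.  A toolkit for the routine step "this
property of the parameters `v : α → K` is expressed by ONE formula of the language of rings,
uniformly in the field `K`" that every transfer / compactness argument over finite and
pseudo-finite fields needs (Chatzidakis–van den Dries–Macintyre 1992, §2, "by pure logic"; used in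
this directory by `UniformBound.lean`, `FiniteFieldTheory.lean`).

Call a property `P K v` of valuations `v : α → K` in fields `K` (in `Type`, with a compatible ring
structure `[FirstOrder.Ring.CompatibleRing K]`) *definable* when
`∃ θ : Language.ring.Formula α, ∀ K v, θ.Realize v ↔ P K v`.  We keep this shape EXPLICIT (no
definition is introduced) so that a definability goal is solved by following the syntax tree of
`P` with `refine`, each step being closed by higher-order pattern unification:

* connectives: `definable_imp`, `definable_and`, `definable_or`, `definable_not`,
  `definable_iInf` (finite conjunctions), `definable_iSup` (finite disjunctions), `definable_true`;
* quantifiers over a finite block of new variables (Mathlib's `Formula.iAlls` / `Formula.iExs`):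
  `definable_forall`, `definable_exists`, and over a finite tuple of tuples `definable_forall₂`,
  `definable_exists₂`;
* atoms: an instance of a given formula at re-indexed variables (`definable_realize₁`,
  `definable_realize₂`, `definable_realize₃`) or at the translate `t + a − a₀` of a tuple
  (`definable_realize₂_add_sub`, through `BoundedFormula.subst`); equality / disequality /
  non-vanishing of tuples of variables (`definable_vecEq`, `definable_vecNe`,
  `definable_vecNeZero`); injectivity of a finite tuple of tuples (`definable_injective`);
  equations and inequations between ring terms (`definable_termEq`, `definable_termNe`), in
  particular for the BOX SUM `Σ_β d_β ∏_l x_l^{β_l}` (`exists_term_realize_boxSum`,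
  `definable_boxSum_eq_zero`, `definable_boxSum_ne_zero`), the generic polynomial of
  multi-degree `≤ N` with indeterminate coefficients, by which "there is a non-zero polynomial of
  bounded degree such that …" becomes first-order.

Terms: `exists_term_realize_pow / _sum / _prod` (iterated products and sums of ring terms).
No finiteness or pseudo-finiteness of `K` is used anywhere.  (A first version of this toolkit was
written inside the Summits tree for the crux `PairwiseCurvedTilingsLC`; this is the generic,
importable form.)

## References

* [ChatzidakisVanDenDriesMacintyre1992] Z. Chatzidakis, L. van den Dries, A. Macintyre, Definable
  sets over finite fields, J. reine angew. Math. 427 (1992) 107–135, §2.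
-/

namespace Literature.ModelTheory.PseudofiniteFields

open FirstOrder FirstOrder.Language FirstOrder.Ring

section Terms

variable {α : Type}

/-- Powers of a ring term are ring terms: some term realises `t ^ n`. [folklore] -/
theorem exists_term_realize_pow (t : Language.ring.Term α) (n : ℕ) :
    ∃ s : Language.ring.Term α, ∀ (K : Type) [Field K] [CompatibleRing K] (v : α → K),
      s.realize v = t.realize v ^ n := by
  induction n with
  | zero => exact ⟨1, fun K _ _ v => by rw [realize_one, pow_zero]⟩
  | succ n ih =>
    obtain ⟨s, hs⟩ := ih
    exact ⟨s * t, fun K _ _ v => by rw [realize_mul, hs, pow_succ]⟩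

/-- Finite sums of ring terms are ring terms: some term realises `∑ i, (f i)`. [folklore] -/
theorem exists_term_realize_sum {ι : Type} [Fintype ι] (f : ι → Language.ring.Term α) :
    ∃ s : Language.ring.Term α, ∀ (K : Type) [Field K] [CompatibleRing K] (v : α → K),
      s.realize v = ∑ i, (f i).realize v := by
  refine ⟨((Finset.univ : Finset ι).toList.map f).foldr (· + ·) 0, fun K _ _ v => ?_⟩
  rw [← Finset.sum_map_toList]
  induction (Finset.univ : Finset ι).toList with
  | nil => simp
  | cons a l ih => simp [ih]

/-- Finite products of ring terms are ring terms: some term realises `∏ i, (f i)`. [folklore] -/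
theorem exists_term_realize_prod {ι : Type} [Fintype ι] (f : ι → Language.ring.Term α) :
    ∃ s : Language.ring.Term α, ∀ (K : Type) [Field K] [CompatibleRing K] (v : α → K),
      s.realize v = ∏ i, (f i).realize v := by
  refine ⟨((Finset.univ : Finset ι).toList.map f).foldr (· * ·) 1, fun K _ _ v => ?_⟩
  rw [← Finset.prod_map_toList]
  induction (Finset.univ : Finset ι).toList with
  | nil => simp
  | cons a l ih => simp [ih]

/-- **The box sum is a ring term.**  For variables `d_β` (`β : Fin m → Fin (N + 1)`, the
coefficients) and `x_l` (`l < m`, the point), some ring term realises the generic polynomial of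
multi-degree `≤ N` evaluated at `x`: `Σ_β d_β ∏_l x_l^{β_l}`. [folklore] -/
theorem exists_term_realize_boxSum (m N : ℕ) (fd : (Fin m → Fin (N + 1)) → α) (fx : Fin m → α) :
    ∃ s : Language.ring.Term α, ∀ (K : Type) [Field K] [CompatibleRing K] (v : α → K),
      s.realize v = ∑ β : Fin m → Fin (N + 1), v (fd β) * ∏ l : Fin m, v (fx l) ^ ((β l : ℕ)) := by
  choose pw hpw using fun (β : Fin m → Fin (N + 1)) (l : Fin m) =>
    exists_term_realize_pow (Term.var (fx l) : Language.ring.Term α) (β l : ℕ)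
  choose pr hpr using fun β : Fin m → Fin (N + 1) => exists_term_realize_prod (pw β)
  obtain ⟨s, hs⟩ := exists_term_realize_sum fun β : Fin m → Fin (N + 1) => Term.var (fd β) * pr β
  refine ⟨s, fun K _ _ v => ?_⟩
  rw [hs]
  refine Finset.sum_congr rfl fun β _ => ?_
  rw [realize_mul, Term.realize_var, hpr]
  refine congrArg _ (Finset.prod_congr rfl fun l _ => ?_)
  rw [hpw, Term.realize_var]

end Terms

section Definability

variable {α β γ : Type}

/-- Definable predicates are closed under implication. [folklore] -/
theorem definable_imp {P Q : ∀ (K : Type) [Field K] [CompatibleRing K], (α → K) → Prop}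
    (hP : ∃ θ : Language.ring.Formula α, ∀ (K : Type) [Field K] [CompatibleRing K] (v : α → K),
      θ.Realize v ↔ P K v)
    (hQ : ∃ θ : Language.ring.Formula α, ∀ (K : Type) [Field K] [CompatibleRing K] (v : α → K),
      θ.Realize v ↔ Q K v) :
    ∃ θ : Language.ring.Formula α, ∀ (K : Type) [Field K] [CompatibleRing K] (v : α → K),
      θ.Realize v ↔ (P K v → Q K v) := by
  obtain ⟨θ, hθ⟩ := hP
  obtain ⟨ψ, hψ⟩ := hQ
  exact ⟨θ.imp ψ, fun K _ _ v => (Formula.realize_imp).trans (imp_congr (hθ K v) (hψ K v))⟩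

/-- Definable predicates are closed under conjunction. [folklore] -/
theorem definable_and {P Q : ∀ (K : Type) [Field K] [CompatibleRing K], (α → K) → Prop}
    (hP : ∃ θ : Language.ring.Formula α, ∀ (K : Type) [Field K] [CompatibleRing K] (v : α → K),
      θ.Realize v ↔ P K v)
    (hQ : ∃ θ : Language.ring.Formula α, ∀ (K : Type) [Field K] [CompatibleRing K] (v : α → K),
      θ.Realize v ↔ Q K v) :
    ∃ θ : Language.ring.Formula α, ∀ (K : Type) [Field K] [CompatibleRing K] (v : α → K),
      θ.Realize v ↔ (P K v ∧ Q K v) := by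
  obtain ⟨θ, hθ⟩ := hP
  obtain ⟨ψ, hψ⟩ := hQ
  exact ⟨θ ⊓ ψ, fun K _ _ v => (Formula.realize_inf).trans (and_congr (hθ K v) (hψ K v))⟩

/-- Definable predicates are closed under disjunction. [folklore] -/
theorem definable_or {P Q : ∀ (K : Type) [Field K] [CompatibleRing K], (α → K) → Prop}
    (hP : ∃ θ : Language.ring.Formula α, ∀ (K : Type) [Field K] [CompatibleRing K] (v : α → K),
      θ.Realize v ↔ P K v)
    (hQ : ∃ θ : Language.ring.Formula α, ∀ (K : Type) [Field K] [CompatibleRing K] (v : α → K),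
      θ.Realize v ↔ Q K v) :
    ∃ θ : Language.ring.Formula α, ∀ (K : Type) [Field K] [CompatibleRing K] (v : α → K),
      θ.Realize v ↔ (P K v ∨ Q K v) := by
  obtain ⟨θ, hθ⟩ := hP
  obtain ⟨ψ, hψ⟩ := hQ
  exact ⟨θ ⊔ ψ, fun K _ _ v => (Formula.realize_sup).trans (or_congr (hθ K v) (hψ K v))⟩

/-- Definable predicates are closed under negation. [folklore] -/
theorem definable_not {P : ∀ (K : Type) [Field K] [CompatibleRing K], (α → K) → Prop}
    (hP : ∃ θ : Language.ring.Formula α, ∀ (K : Type) [Field K] [CompatibleRing K] (v : α → K),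
      θ.Realize v ↔ P K v) :
    ∃ θ : Language.ring.Formula α, ∀ (K : Type) [Field K] [CompatibleRing K] (v : α → K),
      θ.Realize v ↔ ¬ P K v := by
  obtain ⟨θ, hθ⟩ := hP
  exact ⟨θ.not, fun K _ _ v => (Formula.realize_not).trans (not_congr (hθ K v))⟩

/-- The trivially true predicate is definable. [folklore] -/
theorem definable_true :
    ∃ θ : Language.ring.Formula α, ∀ (K : Type) [Field K] [CompatibleRing K] (v : α → K),
      θ.Realize v ↔ True :=
  ⟨⊤, fun _ _ _ _ => Formula.realize_top⟩

/-- Definable predicates are closed under finite conjunctions. [folklore] -/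
theorem definable_iInf {ι : Type} [Finite ι]
    {P : ι → ∀ (K : Type) [Field K] [CompatibleRing K], (α → K) → Prop}
    (h : ∀ i, ∃ θ : Language.ring.Formula α, ∀ (K : Type) [Field K] [CompatibleRing K]
      (v : α → K), θ.Realize v ↔ P i K v) :
    ∃ θ : Language.ring.Formula α, ∀ (K : Type) [Field K] [CompatibleRing K] (v : α → K),
      θ.Realize v ↔ ∀ i, P i K v := by
  choose θ hθ using h
  exact ⟨Formula.iInf θ, fun K _ _ v =>
    (Formula.realize_iInf).trans (forall_congr' fun i => hθ i K v)⟩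

/-- Definable predicates are closed under finite disjunctions. [folklore] -/
theorem definable_iSup {ι : Type} [Finite ι]
    {P : ι → ∀ (K : Type) [Field K] [CompatibleRing K], (α → K) → Prop}
    (h : ∀ i, ∃ θ : Language.ring.Formula α, ∀ (K : Type) [Field K] [CompatibleRing K]
      (v : α → K), θ.Realize v ↔ P i K v) :
    ∃ θ : Language.ring.Formula α, ∀ (K : Type) [Field K] [CompatibleRing K] (v : α → K),
      θ.Realize v ↔ ∃ i, P i K v := by
  choose θ hθ using h
  exact ⟨Formula.iSup θ, fun K _ _ v =>
    (Formula.realize_iSup).trans (exists_congr fun i => hθ i K v)⟩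

/-- Definable predicates are closed under universal quantification over a finite block of new
variables (`Formula.iAlls`). [folklore] -/
theorem definable_forall [Finite β]
    {P : ∀ (K : Type) [Field K] [CompatibleRing K], (α → K) → (β → K) → Prop}
    (h : ∃ θ : Language.ring.Formula (α ⊕ β), ∀ (K : Type) [Field K] [CompatibleRing K]
      (v : α ⊕ β → K), θ.Realize v ↔ P K (fun a => v (Sum.inl a)) (fun b => v (Sum.inr b))) :
    ∃ θ : Language.ring.Formula α, ∀ (K : Type) [Field K] [CompatibleRing K] (v : α → K),
      θ.Realize v ↔ ∀ w : β → K, P K v w := by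
  obtain ⟨θ, hθ⟩ := h
  refine ⟨θ.iAlls β, fun K _ _ v => ?_⟩
  rw [Formula.realize_iAlls]
  refine forall_congr' fun w => ?_
  rw [hθ]
  simp only [Sum.elim_inl, Sum.elim_inr]

/-- Definable predicates are closed under existential quantification over a finite block of new
variables (`Formula.iExs`). [folklore] -/
theorem definable_exists [Finite β]
    {P : ∀ (K : Type) [Field K] [CompatibleRing K], (α → K) → (β → K) → Prop}
    (h : ∃ θ : Language.ring.Formula (α ⊕ β), ∀ (K : Type) [Field K] [CompatibleRing K]
      (v : α ⊕ β → K), θ.Realize v ↔ P K (fun a => v (Sum.inl a)) (fun b => v (Sum.inr b))) :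
    ∃ θ : Language.ring.Formula α, ∀ (K : Type) [Field K] [CompatibleRing K] (v : α → K),
      θ.Realize v ↔ ∃ w : β → K, P K v w := by
  obtain ⟨θ, hθ⟩ := h
  refine ⟨θ.iExs β, fun K _ _ v => ?_⟩
  rw [Formula.realize_iExs]
  refine exists_congr fun w => ?_
  rw [hθ]
  simp only [Sum.elim_inl, Sum.elim_inr]

/-- Definable predicates are closed under universal quantification over a finite tuple of
tuples of new variables. [folklore] -/
theorem definable_forall₂ [Finite β] [Finite γ]
    {P : ∀ (K : Type) [Field K] [CompatibleRing K], (α → K) → (β → γ → K) → Prop}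
    (h : ∃ θ : Language.ring.Formula (α ⊕ β × γ), ∀ (K : Type) [Field K] [CompatibleRing K]
      (v : α ⊕ β × γ → K),
      θ.Realize v ↔ P K (fun a => v (Sum.inl a)) (fun b c => v (Sum.inr (b, c)))) :
    ∃ θ : Language.ring.Formula α, ∀ (K : Type) [Field K] [CompatibleRing K] (v : α → K),
      θ.Realize v ↔ ∀ w : β → γ → K, P K v w := by
  obtain ⟨θ, hθ⟩ := h
  refine ⟨θ.iAlls (β × γ), fun K _ _ v => ?_⟩
  rw [Formula.realize_iAlls]
  constructor
  · intro hall w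
    have hg := hall fun p => w p.1 p.2
    rw [hθ] at hg
    simpa only [Sum.elim_inl, Sum.elim_inr] using hg
  · intro hall g
    rw [hθ]
    simpa only [Sum.elim_inl, Sum.elim_inr] using hall fun b c => g (b, c)

/-- Definable predicates are closed under existential quantification over a finite tuple of
tuples of new variables. [folklore] -/
theorem definable_exists₂ [Finite β] [Finite γ]
    {P : ∀ (K : Type) [Field K] [CompatibleRing K], (α → K) → (β → γ → K) → Prop}
    (h : ∃ θ : Language.ring.Formula (α ⊕ β × γ), ∀ (K : Type) [Field K] [CompatibleRing K]
      (v : α ⊕ β × γ → K),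
      θ.Realize v ↔ P K (fun a => v (Sum.inl a)) (fun b c => v (Sum.inr (b, c)))) :
    ∃ θ : Language.ring.Formula α, ∀ (K : Type) [Field K] [CompatibleRing K] (v : α → K),
      θ.Realize v ↔ ∃ w : β → γ → K, P K v w := by
  obtain ⟨θ, hθ⟩ := h
  refine ⟨θ.iExs (β × γ), fun K _ _ v => ?_⟩
  rw [Formula.realize_iExs]
  constructor
  · rintro ⟨g, hg⟩
    rw [hθ] at hg
    simp only [Sum.elim_inl, Sum.elim_inr] at hg
    exact ⟨_, hg⟩
  · rintro ⟨w, hw⟩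
    refine ⟨fun p => w p.1 p.2, ?_⟩
    rw [hθ]
    simpa only [Sum.elim_inl, Sum.elim_inr] using hw

/-- An instance `φ(v ∘ f)` of a ring formula at re-indexed variables is definable. [folklore] -/
theorem definable_realize₁ (φ : Language.ring.Formula β) (f : β → α) :
    ∃ θ : Language.ring.Formula α, ∀ (K : Type) [Field K] [CompatibleRing K] (v : α → K),
      θ.Realize v ↔ φ.Realize fun b => v (f b) :=
  ⟨φ.relabel f, fun K _ _ v => by rw [Formula.realize_relabel]; rfl⟩

/-- An instance `φ(v ∘ f₁, v ∘ f₂)` of a ring formula at re-indexed variables is definable.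
[folklore] -/
theorem definable_realize₂ {β₁ β₂ : Type} (φ : Language.ring.Formula (β₁ ⊕ β₂)) (f₁ : β₁ → α)
    (f₂ : β₂ → α) :
    ∃ θ : Language.ring.Formula α, ∀ (K : Type) [Field K] [CompatibleRing K] (v : α → K),
      θ.Realize v ↔ φ.Realize (Sum.elim (fun b => v (f₁ b)) (fun b => v (f₂ b))) := by
  refine ⟨φ.relabel (Sum.elim f₁ f₂), fun K _ _ v => ?_⟩
  rw [Formula.realize_relabel]
  exact iff_of_eq (congrArg _ (funext fun x => by cases x <;> rfl))

/-- An instance `φ((v ∘ f₁, v ∘ f₂), v ∘ f₃)` of a ring formula at re-indexed variables is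
definable. [folklore] -/
theorem definable_realize₃ {β₁ β₂ β₃ : Type} (φ : Language.ring.Formula ((β₁ ⊕ β₂) ⊕ β₃))
    (f₁ : β₁ → α) (f₂ : β₂ → α) (f₃ : β₃ → α) :
    ∃ θ : Language.ring.Formula α, ∀ (K : Type) [Field K] [CompatibleRing K] (v : α → K),
      θ.Realize v ↔
        φ.Realize
          (Sum.elim (Sum.elim (fun b => v (f₁ b)) (fun b => v (f₂ b))) (fun b => v (f₃ b))) := by
  refine ⟨φ.relabel (Sum.elim (Sum.elim f₁ f₂) f₃), fun K _ _ v => ?_⟩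
  rw [Formula.realize_relabel]
  exact iff_of_eq (congrArg _ (funext fun x => by rcases x with (x | x) | x <;> rfl))

/-- Realisation of a formula with ring terms substituted for its variables
(`BoundedFormula.subst`), in the `Formula.Realize` typing. [folklore] -/
theorem realize_formula_subst {M : Type} [Language.ring.Structure M] (φ : Language.ring.Formula γ)
    (tf : γ → Language.ring.Term α) (v : α → M) :
    Formula.Realize (BoundedFormula.subst φ tf) v ↔ φ.Realize fun c => (tf c).realize v :=
  BoundedFormula.realize_subst

/-- An instance `φ(t + a − a₀, v ∘ g)` of a ring formula at the TRANSLATE `t + a − a₀` of tuples of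
variables (first block) and at re-indexed variables (second block) is definable (substitute the
terms `x_{f₁ b} + x_{f₂ b} + (−x_{f₃ b})`). [folklore] -/
theorem definable_realize₂_add_sub {β₁ β₂ : Type} (φ : Language.ring.Formula (β₁ ⊕ β₂))
    (f₁ f₂ f₃ : β₁ → α) (g : β₂ → α) :
    ∃ θ : Language.ring.Formula α, ∀ (K : Type) [Field K] [CompatibleRing K] (v : α → K),
      θ.Realize v ↔
        φ.Realize (Sum.elim ((fun b => v (f₁ b)) + (fun b => v (f₂ b)) - fun b => v (f₃ b))
          (fun b => v (g b))) := by
  refine ⟨BoundedFormula.subst φ (Sum.elim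
      (fun b => Term.var (f₁ b) + Term.var (f₂ b) + -Term.var (f₃ b)) (fun b => Term.var (g b))),
    fun K _ _ v => ?_⟩
  rw [realize_formula_subst φ]
  refine iff_of_eq (congrArg _ (funext fun x => ?_))
  rcases x with x | x
  · simp only [Sum.elim_inl, realize_add, realize_neg, Term.realize_var, Pi.add_apply,
      Pi.neg_apply, sub_eq_add_neg]
  · simp only [Sum.elim_inr, Term.realize_var]

/-- Equality of two tuples of variables is definable. [folklore] -/
theorem definable_vecEq {ι : Type} [Finite ι] (f₁ f₂ : ι → α) :
    ∃ θ : Language.ring.Formula α, ∀ (K : Type) [Field K] [CompatibleRing K] (v : α → K),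
      θ.Realize v ↔ (fun i => v (f₁ i)) = fun i => v (f₂ i) := by
  refine ⟨Formula.iInf fun i => Term.equal (Term.var (f₁ i)) (Term.var (f₂ i)),
    fun K _ _ v => ?_⟩
  simp only [Formula.realize_iInf, Formula.realize_equal, Term.realize_var, funext_iff]

/-- Disequality of two tuples of variables is definable. [folklore] -/
theorem definable_vecNe {ι : Type} [Finite ι] (f₁ f₂ : ι → α) :
    ∃ θ : Language.ring.Formula α, ∀ (K : Type) [Field K] [CompatibleRing K] (v : α → K),
      θ.Realize v ↔ (fun i => v (f₁ i)) ≠ fun i => v (f₂ i) :=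
  definable_not (definable_vecEq f₁ f₂)

/-- Non-vanishing of a tuple of variables is definable. [folklore] -/
theorem definable_vecNeZero {ι : Type} [Finite ι] (f : ι → α) :
    ∃ θ : Language.ring.Formula α, ∀ (K : Type) [Field K] [CompatibleRing K] (v : α → K),
      θ.Realize v ↔ (fun i => v (f i)) ≠ 0 := by
  refine ⟨(Formula.iInf fun i => Term.equal (Term.var (f i)) 0).not, fun K _ _ v => ?_⟩
  simp only [Formula.realize_not, Formula.realize_iInf, Formula.realize_equal, Term.realize_var,
    realize_zero, Ne, funext_iff, Pi.zero_apply]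

/-- Injectivity of a finite tuple of tuples of variables ("the tuples `(v (f j ·))_j` are
pairwise distinct") is definable. [folklore] -/
theorem definable_injective {ι κ : Type} [Finite ι] [Finite κ] (f : ι → κ → α) :
    ∃ θ : Language.ring.Formula α, ∀ (K : Type) [Field K] [CompatibleRing K] (v : α → K),
      θ.Realize v ↔ Function.Injective fun j l => v (f j l) := by
  classical
  refine ⟨Formula.iInf fun j => Formula.iInf fun j' =>
    if j = j' then ⊤
    else (Formula.iInf fun l => Term.equal (Term.var (f j l)) (Term.var (f j' l))).not,
    fun K _ _ v => ?_⟩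
  simp only [Formula.realize_iInf]
  constructor
  · intro h j j' hjj'
    by_contra hne
    have := h j j'
    rw [if_neg hne, Formula.realize_not, Formula.realize_iInf] at this
    exact this fun l => by simpa using congrFun hjj' l
  · intro h j j'
    split_ifs with hjj'
    · exact Formula.realize_top.2 trivial
    · rw [Formula.realize_not, Formula.realize_iInf]
      intro hall
      exact hjj' (h (funext fun l => by simpa using hall l))

/-- An equation between two ring terms is definable (an atomic formula). [folklore] -/
theorem definable_termEq (t₁ t₂ : Language.ring.Term α) :
    ∃ θ : Language.ring.Formula α, ∀ (K : Type) [Field K] [CompatibleRing K] (v : α → K),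
      θ.Realize v ↔ t₁.realize v = t₂.realize v :=
  ⟨Term.equal t₁ t₂, fun _ _ _ _ => Formula.realize_equal⟩

/-- An inequation between two ring terms is definable. [folklore] -/
theorem definable_termNe (t₁ t₂ : Language.ring.Term α) :
    ∃ θ : Language.ring.Formula α, ∀ (K : Type) [Field K] [CompatibleRing K] (v : α → K),
      θ.Realize v ↔ t₁.realize v ≠ t₂.realize v :=
  definable_not (definable_termEq t₁ t₂)

/-- The box equation `Σ_β d_β ∏_l x_l^{β_l} = 0` in the variables `d_β := fd β`, `x_l := fx l` is
definable. [folklore] -/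
theorem definable_boxSum_eq_zero (m N : ℕ) (fd : (Fin m → Fin (N + 1)) → α) (fx : Fin m → α) :
    ∃ θ : Language.ring.Formula α, ∀ (K : Type) [Field K] [CompatibleRing K] (v : α → K),
      θ.Realize v ↔
        ∑ β : Fin m → Fin (N + 1), v (fd β) * ∏ l : Fin m, v (fx l) ^ ((β l : ℕ)) = 0 := by
  obtain ⟨s, hs⟩ := exists_term_realize_boxSum m N fd fx
  obtain ⟨θ, hθ⟩ := definable_termEq s 0
  exact ⟨θ, fun K _ _ v => by rw [hθ, hs, realize_zero]⟩

/-- The box inequation `Σ_β d_β ∏_l x_l^{β_l} ≠ 0` in the variables `d_β := fd β`, `x_l := fx l`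
is definable. [folklore] -/
theorem definable_boxSum_ne_zero (m N : ℕ) (fd : (Fin m → Fin (N + 1)) → α) (fx : Fin m → α) :
    ∃ θ : Language.ring.Formula α, ∀ (K : Type) [Field K] [CompatibleRing K] (v : α → K),
      θ.Realize v ↔
        ∑ β : Fin m → Fin (N + 1), v (fd β) * ∏ l : Fin m, v (fx l) ^ ((β l : ℕ)) ≠ 0 :=
  definable_not (definable_boxSum_eq_zero m N fd fx)

end Definability

end Literature.ModelTheory.PseudofiniteFields
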